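import Literature.AlgebraicGeometry.Frobenioids.PadicFrobenioidPerfMulTransport
import Literature.AlgebraicGeometry.Frobenioids.PadicFrobenioidSplittingMonoid
import Literature.AlgebraicGeometry.Frobenioids.PadicFrobenioidPrimitive
import HarnessLib

/-!
# Frobenioids II, Example 1.1 (ii) / Theorem 1.2 (v): the absolutely primitive datum `(ℤ_{≥0}·ord(p), B⊢)` is FUNCTORIAL in
# MULTIPLICATIVE valuative isomorphisms of the base field functor, `p ↦ p` — the `p`-NORMALISED transport of the split datum

S. Mochizuki, *The geometry of Frobenioids II*, Kyushu J. Math. **62** (2008) 401–460, §1, Example 1.1 (ii) pp. 8–9 («If it holds that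
`Φ(K) ⊆ Λ · ord(ℚ_p^×)` […] for every `Spec(K) ∈ Ob(D₀)`, then we shall say that `Φ` is absolutely primitive»; the fibre product `B` at `Λ = ℤ`
is OUR paraphrase, as in abc-iut-L1's `PadicFrobenioidPrimitive`) and Theorem 1.2 (v) p. 9 («the element `p ∈ ℚ_p^×` determines a
characteristic splitting […] on `C`»), proof p. 10 («the image of `p ∈ ℚ_p^×` in `K^×` […] determines a characteristic splitting»)
[cite: MochizukiFrdII2008, Ex 1.1 (ii) p.8]; *The geometry of Frobenioids I*, Kyushu J. Math. **62** (2008), Prop. 5.3 p. 103 (morphisms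
of model data induce functors), Cor. 5.4 p. 104 [cite: MochizukiFrdI2008, Prop. 5.3 p.103].  Consumed by [IUTchI] Ex 3.3 (i) p. 78
(«`Φ_{𝒞⊢_v} : Spec(L) ↦ ord(ℤ^▷_{p_v})`», `ℱ⊢_v := (𝒞⊢_v, τ⊢_v)`), (ii) p. 78 («`𝒪^▷_{𝒞⊢_v}(−) = 𝒪^×_{𝒞⊢_v}(−) × (ℕ·log(p_v))`») and
Cor 5.3 (iii) p. 144 («the natural map `Isom(¹𝔉⊢, ²𝔉⊢) → Isom(¹𝔇⊢, ²𝔇⊢)` [cf. Remark 5.2.1, (i)] is surjective»).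

## What this file builds (abc-iut cell; L1-level brick «PRIM-MUL-TRANSPORT» for abc-iut-L5-t16's row «COR53III-GOOD-SLOT@GENUINE»;
## generic, no IUT vocabulary; the `Φ⊢`-twin of abc-iut-w4-d047's `PadicFrobenioidPerfMulTransport`)

`Datum.prim F` (`Φ⊢(A)` = the powers of `ord(p) ⊗ 1`, `B⊢(A) = K_A^× ×_{Φ₀(A)^gp} Φ⊢(A)^gp`, i.e. the pairs `(u · p^n, n·ord(p))`, `u ∈ 𝒪_{K_A}^×`)
reads ONLY the unit group `𝒪^×_{K_A}` and the element `p` — the monoid `𝒪^× × ℕ·log(p_v)` of [IUTchI] Ex 3.3 (ii) / [AbsTopIII] Prop 5.8 (ii).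
Hence a family of MULTIPLICATIVE homomorphisms `τ_A : (F₁ A).K^× → (F₂ A).K^×` that is (a) integral, (b) natural for the pull-back maps of
`B₀`, and (c) VALUATION-PRESERVING AT `p` (`v(τ_A p) = v(p)`; `τ_A p ≠ p` is allowed — the anabelian units transport of [AbsAnab] Prop 1.2.1
(vi) moves `p` by a unit in general) induces the `p`-NORMALISED morphism of absolutely primitive data over the SAME base `D`:
* §0 `associatesMk_eq_of_valuation_eq`, `divZeroHom_eq_one_of_valuation_eq_one`; §0b `PadicFld.primeUnit` (`p ∈ K^×`, fixed by `B₀(f)`);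
* §1 `primΦTransport A : Φ⊢₁(A) ≃* Φ⊢₂(A)` — generator to generator (`Submonoid.powLogEquiv`); `subtype_primΦTransport` (it IS `(ord τ_A) ⊗ ℝ`
  restricted, by `realificationMap_primGen`: `(ord τ_A ⊗ ℝ)(ord p ⊗ 1) = ord p ⊗ 1`, from (c));
* §2 `primCorr A : Φ⊢₁(A)^gp → (F₂ A).K^×`, `n·ord(p) ↦ (p / τ_A p)^n` — the unit correcting `τ_A` on `p^ℤ` (`divZeroHom_primCorr`: divisor `0`);
  `primMulTransportβ A : B⊢₁(A) → B⊢₂(A)`, `(x, γ) ↦ (τ_A x · primCorr γ, primΦTransport^gp γ)` = “`τ_A` on `𝒪^×`, the identity on `p^ℤ`”,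
  with `primMulTransportβ_primLiftP` — **`p̂ ↦ p̂`** (so the induced functor carries `τ_p` to `τ_p` on the nose; consumer's theorem);
* §3 `primMulTransport F₁ F₂ … τ hτ hnat hτp : ModelFrobenioid.DataHom (Datum.prim F₁ …).divB (Datum.prim F₂ …).divB` (`comm` is `rfl`);
* §4 two-sided inverse from an inverse family `τ'` ⇒ `primMulTransportβ_bijective` (`η` is an equivalence by construction) — the inputs of
  abc-iut-w5-d137's `DataHomOver.functor_isEquivalence` ([FrdI] Cor 5.4).
Binders: `τ`, `hτ`, `hnat`, `hτp` (displayed); 0 instance · 0 notation · no `Prop` fact.  Classical plumbing over landed L1 files; nothing here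
concerns [IUTchIII] Cor. 3.12; no side is taken on any disputed claim.
-/

noncomputable section

namespace Literature.AlgebraicGeometry.Frobenioids

open CategoryTheory Opposite Function
open scoped ValuativeRel

namespace PadicFrd

universe u v

/-! ### §0. Classes of equal valuation; `p` as a unit of a base field -/

section Classes

variable {K : Type u} [Field K] [ValuativeRel K]

/-- **Nonzero integers of equal valuation have the same class in `ord(𝒪_K^⊳)`** (abc-iut-L1 `ordIntToOrdUnits_injective`). [cite: MochizukiFrdII2008, Ex 1.1 (i) p.7] -/
theorem associatesMk_eq_of_valuation_eq (x y : intNonzero K)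
    (h : ValuativeRel.valuation K (x : K) = ValuativeRel.valuation K (y : K)) : Associates.mk x = Associates.mk y := by
  apply ordIntToOrdUnits_injective K
  rw [ordIntToOrdUnits_mk, ordIntToOrdUnits_mk, ordUnitsMk, QuotientGroup.mk'_apply, QuotientGroup.mk'_apply, QuotientGroup.eq,
    mem_unitSubgroup_iff, Units.val_mul, Units.val_inv_eq_inv_val, coe_intNonzeroToUnits, coe_intNonzeroToUnits, map_mul, map_inv₀, h]
  exact inv_mul_cancel₀ ((Valuation.ne_zero_iff _).mpr y.2.2)

/-- An element of `K^×` of valuation `1` has divisor `0` in `(ord(𝒪_K^⊳) ⊗ ℝ_{≥0})^gp` (`ker_divUnits`). [cite: MochizukiFrdII2008, Ex 1.1 (i) p.7] -/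
theorem divZeroHom_eq_one_of_valuation_eq_one (c : Kˣ) (hc : ValuativeRel.valuation K (c : K) = 1) : divZeroHom K c = 1 := by
  have h1 : divUnits K c = 1 := by rw [← MonoidHom.mem_ker, ker_divUnits]; exact hc
  rw [divZeroHom, MonoidHom.comp_apply, h1, map_one]

end Classes

namespace PadicFld

variable {p : ℕ}
/-- **`p ∈ K^×`** for an object `Spec K` of the base `D₀` («the image of `p ∈ ℚ_p^×` in `K^×`», proof of Thm 1.2 (v) p. 10; abc-iut-L1's
`Datum.primeUnit` is this at `K = K_A`). [cite: MochizukiFrdII2008, Thm 1.2 (v) p.10] -/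
def primeUnit (X : PadicFld.{u} p) : X.Kˣ := intNonzeroToUnits X.K ⟨((p : ℕ) : X.K), X.p_mem⟩

/-- The value of `primeUnit` is `p`. [cite: MochizukiFrdII2008, Thm 1.2 (v) p.10] -/
@[simp] theorem coe_primeUnit (X : PadicFld.{u} p) : (X.primeUnit : X.K) = (p : ℕ) := rfl

/-- Morphisms of the base fix `p`: `B₀(f)(p) = p`. [cite: MochizukiFrdII2008, Ex 1.1 (i) p.7] -/
theorem units_map_primeUnit {X Y : PadicFld.{u} p} (f : X ⟶ Y) : Units.map (f.alg : Y.K →* X.K) Y.primeUnit = X.primeUnit :=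
  Units.ext (by
    change f.alg ((p : ℕ) : Y.K) = ((p : ℕ) : X.K)
    exact map_natCast _ p)

end PadicFld

/-! ### §1. The component on `Φ⊢ = ℤ_{≥0} · ord(p)`: generator to generator -/

section Transport

variable {D : Type u} [Category.{v} D] {p : ℕ} [Fact p.Prime]

/-- Bridge (one notion, not two): abc-iut-L1's `Datum.primeUnit d A` IS `(d.base.obj A).primeUnit`. [cite: MochizukiFrdII2008, Thm 1.2 (v) p.10] -/
theorem Datum.primeUnit_eq_primeUnit (d : Datum D p) (A : D) : d.primeUnit A = (d.base.obj A).primeUnit := rfl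

variable (F₁ F₂ : D ⥤ PadicFld.{u} p)
  (hloc₁ : ∀ A : D, (F₁.obj A).IsPadicLocal) (hloc₂ : ∀ A : D, (F₂.obj A).IsPadicLocal)
  (hc : IsConnected D) (he : IsTotallyEpimorphic D)
  (τ : ∀ A : D, (F₁.obj A).Kˣ →* (F₂.obj A).Kˣ)
  (hτ : ∀ (A : D) (x : (F₁.obj A).Kˣ),
    ValuativeRel.valuation (F₁.obj A).K (x : (F₁.obj A).K) ≤ 1 → ValuativeRel.valuation (F₂.obj A).K (τ A x : (F₂.obj A).K) ≤ 1)
  (hnat : ∀ {A A' : D} (f : A' ⟶ A) (x : (F₁.obj A).Kˣ),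
    τ A' (Units.map ((F₁.map f).alg : (F₁.obj A).K →* (F₁.obj A').K) x) =
      Units.map ((F₂.map f).alg : (F₂.obj A).K →* (F₂.obj A').K) (τ A x))
  (hτp : ∀ A : D, ValuativeRel.valuation (F₂.obj A).K (τ A (F₁.obj A).primeUnit : (F₂.obj A).K) =
    ValuativeRel.valuation (F₂.obj A).K ((p : ℕ) : (F₂.obj A).K))

/-- **The component `η_A : Φ⊢₁(A) ⥲ Φ⊢₂(A)`**: `ord(p)^n ⊗ 1 ↦ ord(p)^n ⊗ 1` — both monoids are free on `ord(p) ⊗ 1`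
(abc-iut-L1 `primGen_pow_injective`), and this is the composite of the two exponent isomorphisms with `ℤ_{≥0}`.
[cite: MochizukiFrdII2008, Ex 1.1 (ii) p.8] -/
def primΦTransport (A : D) : ↥(Submonoid.powers (primGen F₁ A)) ≃* ↥(Submonoid.powers (primGen F₂ A)) := by
  classical
  exact (Submonoid.powLogEquiv (primGen_pow_injective F₁ (hloc₁ A))).symm.trans
    (Submonoid.powLogEquiv (primGen_pow_injective F₂ (hloc₂ A)))

/-- The value of `η_A` on `ord(p)^n ⊗ 1`. [cite: MochizukiFrdII2008, Ex 1.1 (ii) p.8] -/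
theorem primΦTransport_pow (A : D) (n : ℕ) :
    primΦTransport F₁ F₂ hloc₁ hloc₂ A ⟨primGen F₁ A ^ n, n, rfl⟩ = ⟨primGen F₂ A ^ n, n, rfl⟩ := by
  classical
  have e₁ : (⟨primGen F₁ A ^ n, n, rfl⟩ : ↥(Submonoid.powers (primGen F₁ A))) = Submonoid.pow (primGen F₁ A) n := rfl
  rw [primΦTransport, e₁, MulEquiv.trans_apply, Submonoid.powLogEquiv_symm_apply, Submonoid.log_pow_eq_self (primGen_pow_injective F₁ (hloc₁ A)),
    Submonoid.powLogEquiv_apply, toAdd_ofAdd]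
  rfl

/-- The value of `η_A` read in `Φ₀(A)`: `ord(p)^n ⊗ 1 ↦ ord(p)^n ⊗ 1`. [cite: MochizukiFrdII2008, Ex 1.1 (ii) p.8] -/
theorem coe_primΦTransport (A : D) (x : ↥(Submonoid.powers (primGen F₁ A))) (n : ℕ) (hx : (x : Realification (OrdInt (F₁.obj A).K)) = primGen F₁ A ^ n) :
    ((primΦTransport F₁ F₂ hloc₁ hloc₂ A x : ↥(Submonoid.powers (primGen F₂ A))) : Realification (OrdInt (F₂.obj A).K)) = primGen F₂ A ^ n := by
  have ex : x = ⟨primGen F₁ A ^ n, n, rfl⟩ := Subtype.ext hx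
  rw [ex, primΦTransport_pow]

omit [Fact p.Prime] in
include hτp in
/-- **`(ord τ_A ⊗ ℝ_{≥0})(ord(p) ⊗ 1) = ord(p) ⊗ 1`**: `τ_A p` and `p` have the same valuation (hypothesis `hτp`), hence the same class in
`ord(𝒪^⊳)`. [cite: MochizukiFrdII2008, Ex 1.1 (ii) p.8] -/
theorem realificationMap_primGen (A : D) : Realification.map (ordIntMapOfUnits (τ A) (hτ A)) (primGen F₁ A) = primGen F₂ A := by
  rw [primGen, Realification.map_of, ordIntMapOfUnits_mk, primGen]
  congr 1
  apply associatesMk_eq_of_valuation_eq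
  rw [coe_unitsIntMap]
  exact hτp A

include hτp in
/-- **`η_A` IS `(ord τ_A) ⊗ ℝ_{≥0}` restricted to `Φ⊢`**: the two agree in `Φ₀(A)` (checked on the powers of the generator).
[cite: MochizukiFrdII2008, Ex 1.1 (ii) p.8] -/
theorem subtype_primΦTransport (A : D) (x : ↥(Submonoid.powers (primGen F₁ A))) :
    ((primΦTransport F₁ F₂ hloc₁ hloc₂ A x : ↥(Submonoid.powers (primGen F₂ A))) : Realification (OrdInt (F₂.obj A).K)) =
      Realification.map (ordIntMapOfUnits (τ A) (hτ A)) (x : Realification (OrdInt (F₁.obj A).K)) := by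
  obtain ⟨y, n, rfl⟩ := x
  rw [coe_primΦTransport F₁ F₂ hloc₁ hloc₂ A ⟨_, n, rfl⟩ n rfl, map_pow, realificationMap_primGen F₁ F₂ τ hτ hτp]

/-- **`η` is natural** for the pull-back maps of `Φ⊢` (both fix the generator, abc-iut-L1 `phi0Map_primGen`).
[cite: MochizukiFrdII2008, Ex 1.1 (ii) p.8] -/
theorem primΦTransport_natural {A A' : Dᵒᵖ} (g : A ⟶ A') (x : ↥(Submonoid.powers (primGen F₁ A.unop))) :
    primΦTransport F₁ F₂ hloc₁ hloc₂ A'.unop (primΦMap F₁ g x) = primΦMap F₂ g (primΦTransport F₁ F₂ hloc₁ hloc₂ A.unop x) := by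
  obtain ⟨y, n, rfl⟩ := x
  apply Subtype.ext
  have h1 : ((primΦMap F₁ g ⟨primGen F₁ A.unop ^ n, n, rfl⟩ : ↥(Submonoid.powers (primGen F₁ A'.unop))) :
      Realification (OrdInt (F₁.obj A'.unop).K)) = primGen F₁ A'.unop ^ n := by
    rw [coe_primΦMap, map_pow, phi0Map_primGen]
  rw [coe_primΦTransport F₁ F₂ hloc₁ hloc₂ A'.unop _ n h1, coe_primΦMap, coe_primΦTransport F₁ F₂ hloc₁ hloc₂ A.unop _ n rfl, map_pow,
    phi0Map_primGen]

/-! ### §2. The correcting unit on `p^ℤ` and the component on `B⊢` -/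

/-- **The correcting unit `c_A := p · (τ_A p)⁻¹ ∈ (F₂ A).K^×`** (of valuation `1` by `hτp`). [cite: MochizukiFrdII2008, Thm 1.2 (v) p.9] -/
def primCorrUnit (A : D) : (F₂.obj A).Kˣ := (F₂.obj A).primeUnit * (τ A (F₁.obj A).primeUnit)⁻¹

omit [Fact p.Prime] in
include hτp in
/-- `v(c_A) = 1`. [cite: MochizukiFrdII2008, Thm 1.2 (v) p.9] -/
theorem valuation_primCorrUnit (A : D) : ValuativeRel.valuation (F₂.obj A).K (primCorrUnit F₁ F₂ τ A : (F₂.obj A).K) = 1 := by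
  rw [primCorrUnit, Units.val_mul, Units.val_inv_eq_inv_val, map_mul, map_inv₀, hτp A, PadicFld.coe_primeUnit]
  exact mul_inv_cancel₀ ((Valuation.ne_zero_iff _).mpr (F₂.obj A).p_mem.2)

/-- **`corr_A : Φ⊢₁(A)^gp → (F₂ A).K^×`, `n · ord(p) ↦ c_A^n`** (through the exponent `deg : Φ⊢₁(A) ≅ ℤ_{≥0}` and the universal property of
the groupification). [cite: MochizukiFrdII2008, Thm 1.2 (v) p.9] -/
def primCorr (A : D) : Algebra.GrothendieckGroup ↥(Submonoid.powers (primGen F₁ A)) →* (F₂.obj A).Kˣ := by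
  classical
  exact Algebra.GrothendieckGroup.lift
    ((powersHom (F₂.obj A).Kˣ (primCorrUnit F₁ F₂ τ A)).comp
      (Submonoid.powLogEquiv (primGen_pow_injective F₁ (hloc₁ A))).symm.toMonoidHom)

/-- The value of `corr_A` on `n · ord(p)`: `c_A^n`. [cite: MochizukiFrdII2008, Thm 1.2 (v) p.9] -/
theorem primCorr_of_pow (A : D) (n : ℕ) :
    primCorr F₁ F₂ hloc₁ τ A (Algebra.GrothendieckGroup.of ⟨primGen F₁ A ^ n, n, rfl⟩) = primCorrUnit F₁ F₂ τ A ^ n := by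
  classical
  have e₁ : (⟨primGen F₁ A ^ n, n, rfl⟩ : ↥(Submonoid.powers (primGen F₁ A))) = Submonoid.pow (primGen F₁ A) n := rfl
  have h := Algebra.GrothendieckGroup.lift.symm_apply_apply
    ((powersHom (F₂.obj A).Kˣ (primCorrUnit F₁ F₂ τ A)).comp
      (Submonoid.powLogEquiv (primGen_pow_injective F₁ (hloc₁ A))).symm.toMonoidHom)
  rw [Algebra.GrothendieckGroup.lift_symm_apply] at h
  have h' := DFunLike.congr_fun h ⟨primGen F₁ A ^ n, n, rfl⟩
  rw [MonoidHom.comp_apply] at h'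
  rw [primCorr, h', MonoidHom.comp_apply, MulEquiv.coe_toMonoidHom, e₁, Submonoid.powLogEquiv_symm_apply,
    Submonoid.log_pow_eq_self (primGen_pow_injective F₁ (hloc₁ A)), powersHom_apply, toAdd_ofAdd]

include hτp in
/-- **`corr_A` has divisor `0`**: `Div₀ ∘ corr_A = 1` (its values are powers of the unit `c_A`). [cite: MochizukiFrdII2008, Thm 1.2 (v) p.9] -/
theorem divZeroHom_primCorr (A : D) (γ : Algebra.GrothendieckGroup ↥(Submonoid.powers (primGen F₁ A))) :
    divZeroHom (F₂.obj A).K (primCorr F₁ F₂ hloc₁ τ A γ) = 1 := by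
  suffices h : (divZeroHom (F₂.obj A).K).comp (primCorr F₁ F₂ hloc₁ τ A) = 1 from DFunLike.congr_fun h γ
  refine MonGp.hom_ext fun a => ?_
  obtain ⟨y, n, rfl⟩ := a
  rw [MonoidHom.comp_apply, primCorr_of_pow, map_pow, divZeroHom_eq_one_of_valuation_eq_one _
    (valuation_primCorrUnit F₁ F₂ τ hτp A), one_pow, MonoidHom.one_apply]

omit [Fact p.Prime] in
include hnat in
/-- **`c` is natural**: the pull-back maps of `B₀` carry `c_A` to `c_{A'}` (field homomorphisms fix `p`; `τ` is natural).
[cite: MochizukiFrdII2008, Thm 1.2 (v) p.9] -/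
theorem units_map_primCorrUnit {A A' : D} (f : A' ⟶ A) :
    Units.map ((F₂.map f).alg : (F₂.obj A).K →* (F₂.obj A').K) (primCorrUnit F₁ F₂ τ A) = primCorrUnit F₁ F₂ τ A' := by
  rw [primCorrUnit, primCorrUnit, map_mul, map_inv, ← hnat f, PadicFld.units_map_primeUnit, PadicFld.units_map_primeUnit]

include hnat in
/-- **`corr` is natural**: `corr_{A'} ∘ Φ⊢₁(f)^gp = B₀(f) ∘ corr_A`. [cite: MochizukiFrdII2008, Thm 1.2 (v) p.9] -/
theorem primCorr_natural {A A' : Dᵒᵖ} (g : A ⟶ A') (γ : Algebra.GrothendieckGroup ↥(Submonoid.powers (primGen F₁ A.unop))) :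
    primCorr F₁ F₂ hloc₁ τ A'.unop (MonGp.map (primΦMap F₁ g) γ) =
      Units.map ((F₂.map g.unop).alg : (F₂.obj A.unop).K →* (F₂.obj A'.unop).K) (primCorr F₁ F₂ hloc₁ τ A.unop γ) := by
  suffices h : (primCorr F₁ F₂ hloc₁ τ A'.unop).comp (MonGp.map (primΦMap F₁ g)) =
      (Units.map ((F₂.map g.unop).alg : (F₂.obj A.unop).K →* (F₂.obj A'.unop).K)).comp (primCorr F₁ F₂ hloc₁ τ A.unop) from
    DFunLike.congr_fun h γ
  refine MonGp.hom_ext fun a => ?_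
  obtain ⟨y, n, rfl⟩ := a
  have h1 : primΦMap F₁ g ⟨primGen F₁ A.unop ^ n, n, rfl⟩ = ⟨primGen F₁ A'.unop ^ n, n, rfl⟩ :=
    Subtype.ext (by rw [coe_primΦMap, map_pow, phi0Map_primGen])
  rw [MonoidHom.comp_apply, MonoidHom.comp_apply, MonGp.map_of, h1, primCorr_of_pow, primCorr_of_pow, map_pow,
    units_map_primCorrUnit F₁ F₂ τ hnat]

include hτ hτp in
/-- The pair `(τ_A x · corr_A γ, η_A^gp γ)` lies in `B⊢₂(A)` whenever `(x, γ) ∈ B⊢₁(A)`: `Div₀ (τ_A x) = (ord τ ⊗ ℝ)^gp (Div₀ x)`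
(abc-iut-w4-d047 `divZeroHom_unitsHom`), `Div₀ (corr γ) = 0`, and `ι₂ ∘ η = (ord τ ⊗ ℝ) ∘ ι₁` on `Φ⊢₁`. [cite: MochizukiFrdII2008, Ex 1.1 (ii) p.8] -/
theorem primMulTransportβ_mem (A : Dᵒᵖ) (x : (F₁.obj A.unop).Kˣ) (γ : Algebra.GrothendieckGroup ↥(Submonoid.powers (primGen F₁ A.unop)))
    (hq : divZeroHom (F₁.obj A.unop).K x = MonGp.map (Submonoid.subtype (Submonoid.powers (primGen F₁ A.unop))) γ) :
    divZeroHom (F₂.obj A.unop).K (τ A.unop x * primCorr F₁ F₂ hloc₁ τ A.unop γ) =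
      MonGp.map (Submonoid.subtype (Submonoid.powers (primGen F₂ A.unop)))
        (MonGp.map (primΦTransport F₁ F₂ hloc₁ hloc₂ A.unop).toMonoidHom γ) := by
  rw [map_mul, divZeroHom_primCorr F₁ F₂ hloc₁ τ hτp, mul_one, divZeroHom_unitsHom (τ A.unop) (hτ A.unop), hq,
    ← MonoidHom.comp_apply, ← MonGp.map_comp, ← MonoidHom.comp_apply, ← MonGp.map_comp]
  congr 1
  refine congrArg MonGp.map (MonoidHom.ext fun y => ?_)
  rw [MonoidHom.comp_apply, MonoidHom.comp_apply, Submonoid.subtype_apply, Submonoid.subtype_apply, MulEquiv.coe_toMonoidHom,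
    subtype_primΦTransport F₁ F₂ hloc₁ hloc₂ τ hτ hτp]

/-- **The component `β_A : B⊢₁(A) → B⊢₂(A)`**: `(x, γ) ↦ (τ_A x · corr_A γ, η_A^gp γ)` — on a pair `(u · p^n, n·ord(p))` (`u` a unit) this is
`(τ_A(u) · p^n, n·ord(p))`: **`τ_A` on `𝒪^×`, the identity on `p^ℤ`** (OUR normalisation). [cite: MochizukiFrdII2008, Ex 1.1 (ii) p.8] -/
def primMulTransportβ (A : Dᵒᵖ) : ↥(primBSub F₁ A) →* ↥(primBSub F₂ A) where
  toFun q := ⟨((τ A.unop q.1.1 * primCorr F₁ F₂ hloc₁ τ A.unop q.1.2 : (F₂.obj A.unop).Kˣ),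
      MonGp.map (primΦTransport F₁ F₂ hloc₁ hloc₂ A.unop).toMonoidHom q.1.2),
    primMulTransportβ_mem F₁ F₂ hloc₁ hloc₂ τ hτ hτp A q.1.1 q.1.2 ((mem_primBSub_iff F₁ A q.1).mp q.2)⟩
  map_one' := Subtype.ext (Prod.ext
    ((congrArg₂ (· * ·) (map_one (τ A.unop)) (map_one (primCorr F₁ F₂ hloc₁ τ A.unop))).trans (mul_one _))
    (map_one (MonGp.map (primΦTransport F₁ F₂ hloc₁ hloc₂ A.unop).toMonoidHom)))
  map_mul' q r := Subtype.ext (Prod.ext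
    ((congrArg₂ (· * ·) (map_mul (τ A.unop) q.1.1 r.1.1) (map_mul (primCorr F₁ F₂ hloc₁ τ A.unop) q.1.2 r.1.2)).trans
      (mul_mul_mul_comm _ _ _ _))
    (map_mul (MonGp.map (primΦTransport F₁ F₂ hloc₁ hloc₂ A.unop).toMonoidHom) q.1.2 r.1.2))
/-- The value of `β_A`: first component `τ_A x · corr_A γ`. [cite: MochizukiFrdII2008, Ex 1.1 (ii) p.8] -/
@[simp] theorem primMulTransportβ_fst (A : Dᵒᵖ) (q : ↥(primBSub F₁ A)) :
    ((primMulTransportβ F₁ F₂ hloc₁ hloc₂ τ hτ hτp A q : ↥(primBSub F₂ A)).1).1 =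
      τ A.unop q.1.1 * primCorr F₁ F₂ hloc₁ τ A.unop q.1.2 := rfl

/-- The value of `β_A`: second component `η_A^gp γ`. [cite: MochizukiFrdII2008, Ex 1.1 (ii) p.8] -/
@[simp] theorem primMulTransportβ_snd (A : Dᵒᵖ) (q : ↥(primBSub F₁ A)) :
    ((primMulTransportβ F₁ F₂ hloc₁ hloc₂ τ hτ hτp A q : ↥(primBSub F₂ A)).1).2 =
      MonGp.map (primΦTransport F₁ F₂ hloc₁ hloc₂ A.unop).toMonoidHom q.1.2 := rfl

/-- **`β_A(p̂) = p̂`**: the distinguished element `(p, ord(p))` of `B⊢₁(A)` (abc-iut-L1 `primLiftP`, which determines the characteristic splitting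
`τ_p` of Thm 1.2 (v)) goes to that of `B⊢₂(A)` — `τ_A p · (p / τ_A p) = p`. [cite: MochizukiFrdII2008, Thm 1.2 (v) p.9] -/
theorem primMulTransportβ_primLiftP (A : Dᵒᵖ) : primMulTransportβ F₁ F₂ hloc₁ hloc₂ τ hτ hτp A (primLiftP F₁ A) = primLiftP F₂ A := by
  have e : ∀ (F : D ⥤ PadicFld.{u} p),
      (⟨primGen F A.unop, Submonoid.mem_powers _⟩ : ↥(Submonoid.powers (primGen F A.unop))) = ⟨primGen F A.unop ^ 1, 1, rfl⟩ :=
    fun F => Subtype.ext (pow_one _).symm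
  refine Subtype.ext (Prod.ext ?_ ?_)
  · rw [primMulTransportβ_fst]
    change τ A.unop (F₁.obj A.unop).primeUnit *
        primCorr F₁ F₂ hloc₁ τ A.unop (Algebra.GrothendieckGroup.of ⟨primGen F₁ A.unop, Submonoid.mem_powers _⟩) = (F₂.obj A.unop).primeUnit
    rw [e F₁, primCorr_of_pow, pow_one, primCorrUnit, mul_comm, inv_mul_cancel_right]
  · rw [primMulTransportβ_snd]
    change MonGp.map (primΦTransport F₁ F₂ hloc₁ hloc₂ A.unop).toMonoidHom (Algebra.GrothendieckGroup.of ⟨primGen F₁ A.unop, Submonoid.mem_powers _⟩) =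
      Algebra.GrothendieckGroup.of ⟨primGen F₂ A.unop, Submonoid.mem_powers _⟩
    rw [MonGp.map_of, MulEquiv.coe_toMonoidHom, e F₁, primΦTransport_pow, e F₂]

/-! ### §3. The morphism of absolutely primitive data -/

/-- **THE `p`-NORMALISED MORPHISM OF ABSOLUTELY PRIMITIVE DATA `(Φ⊢₁, B⊢₁, Div) → (Φ⊢₂, B⊢₂, Div)` induced by `τ`** ([FrdI] Prop 5.3: it induces a
functor of the `p`-adic Frobenioids `𝒞⊢₁ → 𝒞⊢₂`; [FrdII] Ex 1.1 (ii), Thm 1.2 (v)): `η` = generator to generator, `β = (τ · corr, η^gp)`, compatibility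
with `Div_B` (the second projection) definitional. [cite: MochizukiFrdII2008, Ex 1.1 (ii) p.8] -/
def primMulTransport : ModelFrobenioid.DataHom (Datum.prim F₁ hloc₁ hc he).divB (Datum.prim F₂ hloc₂ hc he).divB where
  η :=
    { app := fun A => CommMonCat.ofHom (primΦTransport F₁ F₂ hloc₁ hloc₂ A.unop).toMonoidHom
      naturality := fun {A A'} g => by
        apply CommMonCat.hom_ext
        refine MonoidHom.ext fun x => ?_
        change (primΦTransport F₁ F₂ hloc₁ hloc₂ A'.unop) (primΦMap F₁ g x) = primΦMap F₂ g (primΦTransport F₁ F₂ hloc₁ hloc₂ A.unop x)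
        exact primΦTransport_natural F₁ F₂ hloc₁ hloc₂ g x }
  β :=
    { app := fun A => CommMonCat.ofHom (primMulTransportβ F₁ F₂ hloc₁ hloc₂ τ hτ hτp A)
      naturality := fun {A A'} g => by
        apply CommMonCat.hom_ext
        refine MonoidHom.ext fun q => Subtype.ext (Prod.ext ?_ ?_)
        · change τ A'.unop (Units.map ((F₁.map g.unop).alg : (F₁.obj A.unop).K →* (F₁.obj A'.unop).K) q.1.1) *
              primCorr F₁ F₂ hloc₁ τ A'.unop (MonGp.map (primΦMap F₁ g) q.1.2) =
            Units.map ((F₂.map g.unop).alg : (F₂.obj A.unop).K →* (F₂.obj A'.unop).K)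
              (τ A.unop q.1.1 * primCorr F₁ F₂ hloc₁ τ A.unop q.1.2)
          rw [hnat g.unop q.1.1, primCorr_natural F₁ F₂ hloc₁ τ hnat, map_mul]
        · change MonGp.map (primΦTransport F₁ F₂ hloc₁ hloc₂ A'.unop).toMonoidHom (MonGp.map (primΦMap F₁ g) q.1.2) =
            MonGp.map (primΦMap F₂ g) (MonGp.map (primΦTransport F₁ F₂ hloc₁ hloc₂ A.unop).toMonoidHom q.1.2)
          rw [← MonoidHom.comp_apply, ← MonGp.map_comp, ← MonoidHom.comp_apply, ← MonGp.map_comp]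
          congr 1
          exact congrArg MonGp.map (MonoidHom.ext fun x => primΦTransport_natural F₁ F₂ hloc₁ hloc₂ g x) }
  comm A u := rfl

/-- The `β`-component of `primMulTransport` is `primMulTransportβ`. [cite: MochizukiFrdII2008, Ex 1.1 (ii) p.8] -/
theorem primMulTransport_β_app (A : Dᵒᵖ) :
    ((primMulTransport F₁ F₂ hloc₁ hloc₂ hc he τ hτ hnat hτp).β.app A).hom = primMulTransportβ F₁ F₂ hloc₁ hloc₂ τ hτ hτp A := rfl

/-- **The `η`-components are BIJECTIVE** (no hypothesis: `η_A` is the exponent isomorphism). [cite: MochizukiFrdI2008, Cor. 5.4 p.104] -/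
theorem primMulTransportη_bijective (A : Dᵒᵖ) : Bijective ((primMulTransport F₁ F₂ hloc₁ hloc₂ hc he τ hτ hnat hτp).η.app A).hom :=
  (primΦTransport F₁ F₂ hloc₁ hloc₂ A.unop).bijective
end Transport

/-! ### §4. Two-sided inverse from `τ⁻¹`, hence bijective `β`-components ([FrdI] Cor 5.4's hypothesis) -/

section Inverse

variable {D : Type u} [Category.{v} D] {p : ℕ} [Fact p.Prime] (F₁ F₂ : D ⥤ PadicFld.{u} p)
  (hloc₁ : ∀ A : D, (F₁.obj A).IsPadicLocal) (hloc₂ : ∀ A : D, (F₂.obj A).IsPadicLocal)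
  (hc : IsConnected D) (he : IsTotallyEpimorphic D)
  (τ : ∀ A : D, (F₁.obj A).Kˣ →* (F₂.obj A).Kˣ) (τ' : ∀ A : D, (F₂.obj A).Kˣ →* (F₁.obj A).Kˣ)
  (hτ : ∀ (A : D) (x : (F₁.obj A).Kˣ),
    ValuativeRel.valuation (F₁.obj A).K (x : (F₁.obj A).K) ≤ 1 → ValuativeRel.valuation (F₂.obj A).K (τ A x : (F₂.obj A).K) ≤ 1)
  (hτ' : ∀ (A : D) (x : (F₂.obj A).Kˣ),
    ValuativeRel.valuation (F₂.obj A).K (x : (F₂.obj A).K) ≤ 1 → ValuativeRel.valuation (F₁.obj A).K (τ' A x : (F₁.obj A).K) ≤ 1)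
  (hτp : ∀ A : D, ValuativeRel.valuation (F₂.obj A).K (τ A (F₁.obj A).primeUnit : (F₂.obj A).K) =
    ValuativeRel.valuation (F₂.obj A).K ((p : ℕ) : (F₂.obj A).K))
  (hτ'p : ∀ A : D, ValuativeRel.valuation (F₁.obj A).K (τ' A (F₂.obj A).primeUnit : (F₁.obj A).K) =
    ValuativeRel.valuation (F₁.obj A).K ((p : ℕ) : (F₁.obj A).K))
  (hinv : ∀ (A : D) (x : (F₁.obj A).Kˣ), τ' A (τ A x) = x)

/-- `η' ∘ η = id` (generator to generator twice). [cite: MochizukiFrdII2008, Ex 1.1 (ii) p.8] -/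
theorem primΦTransport_leftInverse (A : D) (x : ↥(Submonoid.powers (primGen F₁ A))) :
    primΦTransport F₂ F₁ hloc₂ hloc₁ A (primΦTransport F₁ F₂ hloc₁ hloc₂ A x) = x := by
  obtain ⟨y, n, rfl⟩ := x
  rw [primΦTransport_pow, primΦTransport_pow]

omit [Fact p.Prime] in
include hinv in
/-- The two correcting units cancel: `τ'_A(c_A) · c'_A = 1` — `τ'(p / τ p) · (p / τ' p) = τ' p · p⁻¹ · p · (τ' p)⁻¹`.
[cite: MochizukiFrdII2008, Thm 1.2 (v) p.9] -/
theorem map_primCorrUnit_mul_primCorrUnit (A : D) :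
    τ' A (primCorrUnit F₁ F₂ τ A) * primCorrUnit F₂ F₁ τ' A = 1 := by
  rw [primCorrUnit, primCorrUnit, map_mul, map_inv, hinv, mul_assoc, inv_mul_cancel_left, mul_inv_cancel]

include hinv in
/-- The `γ`-dependent unit factors of `β' ∘ β` cancel: `τ'_A(corr_A γ) · corr'_A(η_A^gp γ) = 1` (a homomorphism in `γ` killing the generator,
`map_primCorrUnit_mul_primCorrUnit`). [cite: MochizukiFrdII2008, Thm 1.2 (v) p.9] -/
theorem map_primCorr_mul_primCorr (A : D) (γ : Algebra.GrothendieckGroup ↥(Submonoid.powers (primGen F₁ A))) :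
    τ' A (primCorr F₁ F₂ hloc₁ τ A γ) * primCorr F₂ F₁ hloc₂ τ' A (MonGp.map (primΦTransport F₁ F₂ hloc₁ hloc₂ A).toMonoidHom γ) = 1 := by
  have h : ((τ' A).comp (primCorr F₁ F₂ hloc₁ τ A)) *
      ((primCorr F₂ F₁ hloc₂ τ' A).comp (MonGp.map (primΦTransport F₁ F₂ hloc₁ hloc₂ A).toMonoidHom)) = 1 := by
    refine MonGp.hom_ext fun a => ?_
    obtain ⟨y, n, rfl⟩ := a
    rw [MonoidHom.mul_apply, MonoidHom.comp_apply, MonoidHom.comp_apply, MonGp.map_of, MulEquiv.coe_toMonoidHom, primΦTransport_pow,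
      primCorr_of_pow, primCorr_of_pow, map_pow, ← mul_pow, map_primCorrUnit_mul_primCorrUnit F₁ F₂ τ τ' hinv, one_pow,
      MonoidHom.one_apply]
  rw [← MonoidHom.comp_apply (τ' A), ← MonoidHom.comp_apply (primCorr F₂ F₁ hloc₂ τ' A), ← MonoidHom.mul_apply, h, MonoidHom.one_apply]

include hinv in
/-- `β' ∘ β = id` on the fibre products. [cite: MochizukiFrdII2008, Ex 1.1 (ii) p.8] -/
theorem primMulTransportβ_leftInverse (A : Dᵒᵖ) (q : ↥(primBSub F₁ A)) :
    primMulTransportβ F₂ F₁ hloc₂ hloc₁ τ' hτ' hτ'p A (primMulTransportβ F₁ F₂ hloc₁ hloc₂ τ hτ hτp A q) = q := by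
  have h : (primΦTransport F₂ F₁ hloc₂ hloc₁ A.unop).toMonoidHom.comp (primΦTransport F₁ F₂ hloc₁ hloc₂ A.unop).toMonoidHom = MonoidHom.id _ :=
    MonoidHom.ext fun x => primΦTransport_leftInverse F₁ F₂ hloc₁ hloc₂ A.unop x
  refine Subtype.ext (Prod.ext ?_ ?_)
  · rw [primMulTransportβ_fst, primMulTransportβ_fst, primMulTransportβ_snd, map_mul (τ' A.unop), hinv, mul_assoc,
      map_primCorr_mul_primCorr F₁ F₂ hloc₁ hloc₂ τ τ' hinv, mul_one]
  · rw [primMulTransportβ_snd, primMulTransportβ_snd, ← MonoidHom.comp_apply, ← MonGp.map_comp, h, MonGp.map_id, MonoidHom.id_apply]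

variable (hinv' : ∀ (A : D) (y : (F₂.obj A).Kˣ), τ A (τ' A y) = y)

include τ' hτ' hτ'p hinv hinv' in
/-- **`β_A` is BIJECTIVE** when `τ` has a two-sided integral inverse `τ'` (valuation-preserving at `p`). [cite: MochizukiFrdI2008, Cor. 5.4 p.104] -/
theorem primMulTransportβ_bijective (A : Dᵒᵖ) : Bijective (primMulTransportβ F₁ F₂ hloc₁ hloc₂ τ hτ hτp A) :=
  Function.bijective_iff_has_inverse.mpr ⟨primMulTransportβ F₂ F₁ hloc₂ hloc₁ τ' hτ' hτ'p A,
    fun q => primMulTransportβ_leftInverse F₁ F₂ hloc₁ hloc₂ τ τ' hτ hτ' hτp hτ'p hinv A q,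
    fun q => primMulTransportβ_leftInverse F₂ F₁ hloc₂ hloc₁ τ' τ hτ' hτ hτ'p hτp hinv' A q⟩

end Inverse

end PadicFrd

end Literature.AlgebraicGeometry.Frobenioids

end
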